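import Summits.BirchSwinnertonDyer.BirchSwinnertonDyer.Theorems.EisensteinPrimesBSDpOnCellCTelescopeK2InertiaFrobeniusAnnihilator
import Summits.BirchSwinnertonDyer.BirchSwinnertonDyer.Theorems.EisensteinPrimesBSDpOnCellCTelescopeK2WeightTwoControlMapOfFrobenius
import Literature.NumberTheory.EllipticCurves.InertiaCohomologyPrimaryTorsionFiniteProofs
import Literature.NumberTheory.EllipticCurves.ZpExtensionUnramifiedProofs
import HarnessLib

/-!
# Crux 4 `BSDpOnCellC` (stmt-BirchSwinnertonDyer-19034), line `telescope`, leaf N2 / sub-leaf W2: HYPOTHESIS (ann) OF p752662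
# DISCHARGED — the Frobenius annihilators on `A₂^{I_w}/X·A₂^{I_w}` at EVERY `w ∤ p` from N1's fibre data alone, and W2's control map
# `∃ α : X^∅_𝔭bar/(C X) → Sel(M₂[C X])^∨` from FD-shapes + (split) [+ Heegner] with NO inertia-side hypothesis left
# (helper, `--supports stmt-BirchSwinnertonDyer-19034 --as helper`; closes nothing; NOT the registered text)

Cell `bsd-eis`, width seat `bsd-line-x2-p2` (prover g20, 2026-08-30; D-0154 KEY row 5). THEOREMS ONLY: no definition, no named fact,
no `sorry`, no instance, no notation. Instantiates the generic core `TelescopeK2InertiaFrobeniusAnnihilator` (this seat) at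
`(𝒪, c, A, ρ) = (ℤ_p⟦X⟧, X, A₂, ρ₂|Γ_{K_w})`:

* §1 `aeval_map_algebraMap_apply_eq`, `exists_monic_aeval_inertiaInvariants_mem` — the annihilator with `P ∈ 𝒪[Y]` (image of the
  `ℤ_p[Y]`-annihilator), `P(ρ d)` formed in `End_𝒪(A)`.
* §2 **`exists_monic_frobeniusAnnihilator_of_fibreData`** — (ann) BY NAME, for EVERY finite place `w ∤ p` of the number field `K` and
  every `d ∈ Γ_{K_w}`: from (tor) `A₂` is `X`-power torsion, (cof) `X`-divisible, and (fd₀) an additive `θ₀ : A₂[X] → E_K[p^∞]` with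
  FINITE KERNEL (no equivariance needed): `∃ P : ℤ_p⟦X⟧[Y]` monic with `P(ρ₂(res d)) · A₂^{I_w} ⊆ X · A₂^{I_w}`, in the token shape of
  hypothesis `hann` of `TelescopeK2WeightTwoControlMapOfFrobenius.exists_weightTwoControlMap_of_frobenius_of_split`. The `ℤ_p`-module
  structure on `A₂` is the one through `ℤ_p → ℤ_p⟦X⟧` (local, `Module.compHom`); the arbitrary topology on `ℤ_p⟦X⟧` (N1's existential)
  is never used.
* §3 **`exists_weightTwoControlMap_of_split`**, **`exists_weightTwoControlMap_of_heegner`** — p752662's two theorems with (ann) discharged: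
  W2's conclusion `∃ α : QuotSMulTop (C X) (XBig κ ρ₂ 𝔭bar ∅) →ₗ Sel(M₂[C X])^∨` (kernel killed prime to `C X`, finite cokernel) from
  N1-shaped (tor)/(cof₀)/(unr)/(fd₀) + (split) + (deg₁), resp. + Heegner and «the bad primes away from `p` divide `N₀`».

NET FOR W2 (by name): after this file the ONLY non-FD hypothesis of W2's conclusion on Cell C's Heegner field is (split)
`W.HasSplitMultiplicativeReductionAtPrime p` (the non-split twin of bsd-stepL's Tate chain (L1) is not in the tree) — plus the road
prefix (`K` imaginary quadratic, `p` odd, `κ` anticyclotomic, `𝔭bar ∣ p` of degree one, Heegner for `N₀`, bad `w ∤ p` dividing `N₀`).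

HONEST FRAMING: assembly of tree theorems over binders; the branch lattice `ρ₂` is a binder, not constructed; nothing about any curve's
BSD is proved; no registered stub, crux or summit statement is proved by this file; closes: none.

References: [JetchevSkinnerWan2017] §3.4, Lemma 3.4.1 (arXiv:1512.06894 p. 14); [GreenbergVatsal2000] §2 Prop. 2.4; [Castella2018Erratum]
Lemma 2.1 (p. 2); [Brink2007] Thm. 2, Cor. 1 (pp. 2134–2136); [Gross1991] §1; [SilvermanAEC2009] Cor. III.6.4.
-/

noncomputable section

-- D-0017: single-problem summit, the namespace repeats the problem name by design.
set_option linter.dupNamespace false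
set_option autoImplicit false

open Field IsDedekindDomain NumberField WeierstrassCurve
open Literature.NumberTheory.GaloisRepresentations Literature.NumberTheory.EllipticCurves
  Literature.NumberTheory.EllipticCurves.BigGaloisRep
open Summit.BirchSwinnertonDyer.Rank1Residual.X11b

namespace Summit.BirchSwinnertonDyer.BirchSwinnertonDyer.Theorems.TelescopeK2InertiaFrobeniusAnnihilatorBranch

/-! ## §1 The annihilator with coefficients in `𝒪` -/

section Coeff

open Literature.NumberTheory.GaloisRepresentations.IsNonarchimedeanLocalField

/-- `P(f) a` computed through `R → S`: for `P ∈ R[Y]`, `P^S(f) a = P(f|_R) a` (`P^S` the image of `P` in `S[Y]`). [folklore] -/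
theorem aeval_map_algebraMap_apply_eq {R : Type*} [CommRing R] {S : Type*} [CommRing S] [Algebra R S] {M : Type*}
    [AddCommGroup M] [Module S M] [Module R M] [IsScalarTower R S M] (f : Module.End S M) (P : Polynomial R) (a : M) :
    Polynomial.aeval f (P.map (algebraMap R S)) a = Polynomial.aeval (f.restrictScalars R) P a := by
  have hpow : ∀ (n : ℕ) (a : M), (f ^ n) a = ((f.restrictScalars R) ^ n) a := by
    intro n
    induction n with
    | zero => intro a; rfl
    | succ n ih =>
      intro a
      rw [pow_succ, pow_succ, Module.End.mul_apply, Module.End.mul_apply, LinearMap.restrictScalars_apply, ih]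
  induction P using Polynomial.induction_on' with
  | add P Q hP hQ => rw [Polynomial.map_add, map_add, map_add, LinearMap.add_apply, LinearMap.add_apply, hP, hQ]
  | monomial n r =>
    rw [Polynomial.map_monomial, Polynomial.aeval_monomial, Polynomial.aeval_monomial, Module.End.mul_apply,
      Module.End.mul_apply, Module.algebraMap_end_apply, Module.algebraMap_end_apply, hpow, algebraMap_smul]

/-- **THE ANNIHILATOR (over `𝒪`)**: `F` a non-archimedean local field of residue characteristic `≠ p`, `𝒪` a `ℤ_p`-algebra (any
topology), `A` a discrete `p`-primary `𝒪`-module with a continuous `𝒪`-linear `Γ_F`-action `ρ`, `c ∈ 𝒪` acting surjectively, `A[c][p]`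
finite: for every `d ∈ Γ_F` a MONIC `P ∈ 𝒪[Y]` with `P(ρ d) a ∈ c · A^{I_F}` for all `a ∈ A^{I_F}` (the `ℤ_p[Y]`-annihilator of
`TelescopeK2InertiaFrobeniusAnnihilator.exists_monic_aeval_restrictScalars_inertiaInvariants_mem`, mapped to `𝒪[Y]`).
[cite: JetchevSkinnerWan2017, §3.4, proof of Lemma 3.4.1 (arXiv:1512.06894 p. 14)] [cite: GreenbergVatsal2000, §2, proof of Prop. 2.4] -/
theorem exists_monic_aeval_inertiaInvariants_mem (F : Type) [Field F] [ValuativeRel F] [TopologicalSpace F]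
    [IsNonarchimedeanLocalField F] {p : ℕ} [Fact p.Prime]
    {𝒪 : Type*} [CommRing 𝒪] [TopologicalSpace 𝒪] [Algebra ℤ_[p] 𝒪]
    {A : Type} [AddCommGroup A] [Module 𝒪 A] [Module ℤ_[p] A] [IsScalarTower ℤ_[p] 𝒪 A] [TopologicalSpace A] [DiscreteTopology A]
    (hℓ : ringChar (IsLocalRing.ResidueField (ValuativeRel.valuation F).integer) ≠ p)
    (ρ : ContinuousRep (absoluteGaloisGroup F) 𝒪 A) (c : 𝒪)
    (hA : ∀ a : A, ∃ k : ℕ, p ^ k • a = 0) (hdiv : ∀ a : A, ∃ b : A, c • b = a)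
    (hfin : {a : A | c • a = 0 ∧ p • a = 0}.Finite) (d : absoluteGaloisGroup F) :
    ∃ P : Polynomial 𝒪, P.Monic ∧ ∀ a : A, (∀ i ∈ absInertia F, ρ i a = a) →
      ∃ a₀ : A, (∀ i ∈ absInertia F, ρ i a₀ = a₀) ∧ c • a₀ = Polynomial.aeval (ρ d) P a := by
  obtain ⟨P, hPmon, hP⟩ :=
    TelescopeK2InertiaFrobeniusAnnihilator.exists_monic_aeval_restrictScalars_inertiaInvariants_mem F hℓ ρ c hA hdiv hfin d
  refine ⟨P.map (algebraMap ℤ_[p] 𝒪), hPmon.map _, fun a ha => ?_⟩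
  obtain ⟨a₀, ha₀, h⟩ := hP a ha
  exact ⟨a₀, ha₀, by rw [h, aeval_map_algebraMap_apply_eq]⟩

end Coeff

/-! ## §2 (ann) BY NAME: the Frobenius annihilators of the branch lattice from N1's fibre data -/

section Branch

variable {K : Type} [Field K] [NumberField K] {p : ℕ} [Fact p.Prime] (W : WeierstrassCurve ℚ) [W.IsElliptic]

/-- In an additive group, the fibres of a homomorphism with finite kernel are finite. [folklore] -/
theorem finite_preimage_singleton_of_finite_ker {M N : Type*} [AddCommGroup M] [AddCommGroup N] (θ : M →+ N)
    (hker : Finite θ.ker) (b : N) : (θ ⁻¹' {b}).Finite := by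
  by_cases hb : (θ ⁻¹' {b}).Nonempty
  · obtain ⟨x₀, hx₀⟩ := hb
    haveI := hker
    refine Set.Finite.of_finite_image (f := fun x => x - x₀) ?_ fun x _ y _ hxy => sub_left_inj.1 hxy
    refine (Set.finite_univ.image (fun k : θ.ker => (k : M))).subset ?_
    rintro _ ⟨x, hx, rfl⟩
    refine ⟨⟨x - x₀, ?_⟩, Set.mem_univ _, rfl⟩
    rw [AddMonoidHom.mem_ker, map_sub, show θ x = b from hx, show θ x₀ = b from hx₀, sub_self]
  · rw [Set.not_nonempty_iff_eq_empty.1 hb]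
    exact Set.finite_empty

/-- **HYPOTHESIS (ann) OF p752662, PROVED — for EVERY finite place `w ∤ p` and every `d ∈ Γ_{K_w}`.** `A₂` a discrete `ℤ_p⟦X⟧`-module
(any topology on `ℤ_p⟦X⟧`) with a continuous `ℤ_p⟦X⟧`-linear `Γ_K`-action `ρ₂`, (tor) `X`-power torsion, (cof) `X`-divisible, and (fd₀) an
additive `θ₀ : A₂[X] → E_K[p^∞]` with finite kernel (`E = W/ℚ` elliptic; NO equivariance is used): there is a MONIC `P ∈ ℤ_p⟦X⟧[Y]` such
that every `I_w`-invariant `a ∈ A₂` has `P(ρ₂(res d)) a = X · a₀` with `a₀` `I_w`-invariant. PROOF: `A₂` is `p`-primary ((tor) + (fd₀),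
as in p752662), `A₂[X][p]` is finite (finite kernel into `E[p]`), the residue characteristic of `K_w` is `≠ p`; apply §1 to
`ρ₂|Γ_{K_w}` with the `ℤ_p`-structure through `ℤ_p → ℤ_p⟦X⟧`.
[cite: JetchevSkinnerWan2017, §3.4, Lemma 3.4.1 (arXiv:1512.06894 p. 14)] [cite: GreenbergVatsal2000, §2 Prop. 2.4]
[cite: SilvermanAEC2009, Cor. III.6.4] -/
theorem exists_monic_frobeniusAnnihilator_of_fibreData
    [TopologicalSpace (PowerSeries ℤ_[p])] (A₂ : Type) [AddCommGroup A₂] [Module (PowerSeries ℤ_[p]) A₂]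
    [TopologicalSpace A₂] [DiscreteTopology A₂]
    (ρ₂ : ContinuousRep (absoluteGaloisGroup K) (PowerSeries ℤ_[p]) A₂)
    (htor : ∀ a : A₂, ∃ n : ℕ, (PowerSeries.X : PowerSeries ℤ_[p]) ^ n • a = 0)
    (hcof : ∀ a : A₂, ∃ b : A₂, (PowerSeries.X : PowerSeries ℤ_[p]) • b = a)
    (θ₀ : Submodule.torsionBy (PowerSeries ℤ_[p]) A₂ (PowerSeries.X : PowerSeries ℤ_[p]) →+
      PrimaryTorsion (W.baseChange K).geomPoints p)
    (hker : Finite θ₀.ker)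
    (w : HeightOneSpectrum (𝓞 K)) (hw : ((p : ℕ) : 𝓞 K) ∉ w.asIdeal) (d : LocalGroup K (Sum.inl w)) :
    ∃ P : Polynomial (PowerSeries ℤ_[p]), P.Monic ∧
      ∀ a : A₂, (∀ h : LocalGroup K (Sum.inr w), ρ₂ (localMap K (Sum.inr w) h) a = a) →
        ∃ a₀ : A₂, (∀ h : LocalGroup K (Sum.inr w), ρ₂ (localMap K (Sum.inr w) h) a₀ = a₀) ∧
          (PowerSeries.X : PowerSeries ℤ_[p]) • a₀ = (Polynomial.aeval (ρ₂ (localMap K (Sum.inl w) d)) P) a := by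
  classical
  -- the `ℤ_p`-module structure through `ℤ_p → ℤ_p⟦X⟧`
  letI : Module ℤ_[p] A₂ := Module.compHom A₂ (algebraMap ℤ_[p] (PowerSeries ℤ_[p]))
  haveI : IsScalarTower ℤ_[p] (PowerSeries ℤ_[p]) A₂ := IsScalarTower.of_algebraMap_smul fun _ _ => rfl
  -- `A₂` is `p`-primary ((tor) + (fd₀))
  have hPT : ∀ e : PrimaryTorsion (W.baseChange K).geomPoints p, IsOfFinAddOrder e := fun e => by
    obtain ⟨k, hk⟩ := PrimaryTorsion.exists_pow_smul_eq_zero e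
    refine (isOfFinAddOrder_iff_nsmul_eq_zero).2 ⟨p ^ k, pow_pos (Nat.Prime.pos Fact.out) k, ?_⟩
    apply PrimaryTorsion.ext
    rw [PrimaryTorsion.val_nsmul, hk, PrimaryTorsion.val_zero]
  have htors : ∀ a : A₂, IsOfFinAddOrder a :=
    TelescopeK2BigRepDivisible.isOfFinAddOrder_of_pow_torsion PowerSeries.X htor
      (TelescopeK2BigRepDivisible.isOfFinAddOrder_of_torsionBy PowerSeries.X θ₀ hker hPT)
  have hA : ∀ a : A₂, ∃ k : ℕ, p ^ k • a = 0 := fun a =>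
    TelescopeK2WeightTwoControlMapOfFrobenius.exists_pow_smul_eq_zero_of_isOfFinAddOrder (htors a)
  -- `A₂[X][p]` is finite: finite kernel into `E[p^∞]`, whose `p`-torsion is finite
  have hfin : {a : A₂ | (PowerSeries.X : PowerSeries ℤ_[p]) • a = 0 ∧ p • a = 0}.Finite := by
    haveI := (W.baseChange K).finite_torsionBy_int_primaryTorsion p 1
    set T : Set (PrimaryTorsion (W.baseChange K).geomPoints p) := {e | p • e = 0} with hT
    have hTfin : T.Finite := by
      refine (Set.finite_univ.image (fun x : Submodule.torsionBy ℤ (PrimaryTorsion (W.baseChange K).geomPoints p)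
        ((p ^ 1 : ℕ) : ℤ) => (x : PrimaryTorsion (W.baseChange K).geomPoints p))).subset fun e he => ?_
      refine ⟨⟨e, (Submodule.mem_torsionBy_iff _ _).2 ?_⟩, Set.mem_univ _, rfl⟩
      rw [pow_one, natCast_zsmul]
      exact he
    have hpre : (θ₀ ⁻¹' T).Finite :=
      hTfin.preimage' fun b _ => finite_preimage_singleton_of_finite_ker θ₀ hker b
    refine (hpre.image fun x : Submodule.torsionBy (PowerSeries ℤ_[p]) A₂ (PowerSeries.X : PowerSeries ℤ_[p]) =>
      (x : A₂)).subset ?_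
    rintro a ⟨haX, hap⟩
    refine ⟨⟨a, (Submodule.mem_torsionBy_iff _ _).2 haX⟩, ?_, rfl⟩
    change p • θ₀ _ = 0
    rw [← map_nsmul]
    convert θ₀.map_zero using 2
    exact Subtype.ext (by rw [AddSubmonoidClass.coe_nsmul, hap, ZeroMemClass.coe_zero])
  -- the local field `K_w` has residue characteristic `≠ p`
  have hℓ := w.ringChar_residueField_adicCompletion_ne hw
  obtain ⟨P, hPmon, hP⟩ := exists_monic_aeval_inertiaInvariants_mem (w.adicCompletion K) hℓ
    (ρ₂.restrict (localMap K (Sum.inl w))) (PowerSeries.X : PowerSeries ℤ_[p]) hA hcof hfin d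
  refine ⟨P, hPmon, fun a ha => ?_⟩
  obtain ⟨a₀, ha₀, h⟩ := hP a fun i hi => ha ⟨i, hi⟩
  exact ⟨a₀, fun h' => ha₀ h'.1 h'.2, h⟩

end Branch

/-! ## §3 W2's control map from N1's fibre data + (split) [+ Heegner]: p752662 with (ann) discharged -/

section ControlMap

variable {K : Type} [Field K] [NumberField K] {p : ℕ} [Fact p.Prime]

/-- **SUB-LEAF W2 FROM FIBRE DATA + (split) + (deg₁) — NO inertia-side hypothesis.** p752662's
`TelescopeK2WeightTwoControlMapOfFrobenius.exists_weightTwoControlMap_of_frobenius_of_split` with its hypothesis (ann) discharged by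
`exists_monic_frobeniusAnnihilator_of_fibreData` (§2): for `K` imaginary quadratic, `p ≠ 2`, `κ` anticyclotomic, `𝔭bar ∋ p` of degree
one, `E = W/ℚ` SPLIT multiplicative at `p`, `ρ₂ : Γ_K → Aut_{ℤ_p⟦X⟧}(A₂)` with (tor), (cof₀), (unr `S₀`), (fd₀ `θ₀`, finite kernel) and
(deg₁) «every `w ∈ S₀` with `w ∤ p` has `e = f = 1`»: `∃ α : QuotSMulTop (C X) (XBig κ ρ₂ 𝔭bar ∅) →ₗ Sel(M₂[C X])^∨` with kernel killed
elementwise by scalars prime to `C X` and FINITE cokernel (the conclusion text of `K2Weight2.stub_weightTwoControlMap` for these objects).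
[cite: JetchevSkinnerWan2017, §3.4, Lemma 3.4.1 (arXiv:1512.06894 p. 14)] [cite: Castella2018Erratum, Lemma 2.1 (p. 2)]
[cite: Brink2007, Thm. 2 and Cor. 1 (pp. 2134–2136)] [cite: GreenbergVatsal2000, Prop. 2.4] -/
theorem exists_weightTwoControlMap_of_split
    (W : WeierstrassCurve ℚ) [W.IsElliptic] (hK : IsImaginaryQuadratic K) (hp2 : p ≠ 2)
    (hsplit : W.HasSplitMultiplicativeReductionAtPrime p)
    (κ : ZpExtension K p) (hκ : κ.IsAnticyclotomic)
    (𝔭bar : HeightOneSpectrum (𝓞 K)) (h𝔭bar : ((p : ℕ) : 𝓞 K) ∈ 𝔭bar.asIdeal)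
    (he : 𝔭bar.asIdeal.ramificationIdx (𝓞 ℚ) = 1) (hf : 𝔭bar.asIdeal.inertiaDeg (𝓞 ℚ) = 1)
    [TopologicalSpace (PowerSeries ℤ_[p])] (A₂ : Type) [AddCommGroup A₂] [Module (PowerSeries ℤ_[p]) A₂]
    [TopologicalSpace A₂] [DiscreteTopology A₂]
    (ρ₂ : ContinuousRep (absoluteGaloisGroup K) (PowerSeries ℤ_[p]) A₂)
    [TopologicalSpace (PowerSeries (PowerSeries ℤ_[p]))]
    [ContinuousSMul (PowerSeries (PowerSeries ℤ_[p])) (BigRepModule (PowerSeries ℤ_[p]) p A₂)]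
    -- (tor), (cof₀), (unr), (fd₀) of N1's fibre data
    (htor : ∀ a : A₂, ∃ n : ℕ, (PowerSeries.X : PowerSeries ℤ_[p]) ^ n • a = 0)
    (hcof : ∀ a : A₂, ∃ b : A₂, (PowerSeries.X : PowerSeries ℤ_[p]) • b = a)
    (S₀ : Finset (HeightOneSpectrum (𝓞 K))) (hunr : GaloisRep.IsUnramifiedOutside (S₀ : Set (HeightOneSpectrum (𝓞 K))) ρ₂)
    (θ₀ : Submodule.torsionBy (PowerSeries ℤ_[p]) A₂ (PowerSeries.X : PowerSeries ℤ_[p]) →+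
      PrimaryTorsion (W.baseChange K).geomPoints p)
    (hθσ : ∀ (σ : absoluteGaloisGroup K)
      (a : Submodule.torsionBy (PowerSeries ℤ_[p]) A₂ (PowerSeries.X : PowerSeries ℤ_[p])),
      θ₀ (BigGaloisRep.torsionRep ρ₂ (PowerSeries.X : PowerSeries ℤ_[p]) σ a) =
        (W.baseChange K).primaryTorsionGaloisRep p σ (θ₀ a))
    (hker : Finite θ₀.ker)
    -- (deg₁): the bad primes away from `p` have degree one (Heegner)
    (hdeg : ∀ w ∈ S₀, ((p : ℕ) : 𝓞 K) ∉ w.asIdeal →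
      w.asIdeal.ramificationIdx (𝓞 ℚ) = 1 ∧ w.asIdeal.inertiaDeg (𝓞 ℚ) = 1) :
    ∃ α : QuotSMulTop (PowerSeries.C (PowerSeries.X : PowerSeries ℤ_[p])) (XBig κ ρ₂ 𝔭bar (∅ : Set (HeightOneSpectrum (𝓞 K))))
        →ₗ[PowerSeries (PowerSeries ℤ_[p])]
        CharacterModule (TorsionControl.selmer (localMap K) (strictSet p 𝔭bar (∅ : Set (HeightOneSpectrum (𝓞 K))))
          (TorsionControl.torsionRep (AnticyclotomicBigGaloisRep κ ρ₂) (PowerSeries.C (PowerSeries.X : PowerSeries ℤ_[p])))),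
      (∀ m ∈ LinearMap.ker α, ∃ s : PowerSeries (PowerSeries ℤ_[p]),
        ¬ ((PowerSeries.C (PowerSeries.X : PowerSeries ℤ_[p])) ∣ s) ∧ s • m = 0) ∧
      Finite ((CharacterModule (TorsionControl.selmer (localMap K) (strictSet p 𝔭bar (∅ : Set (HeightOneSpectrum (𝓞 K))))
        (TorsionControl.torsionRep (AnticyclotomicBigGaloisRep κ ρ₂) (PowerSeries.C (PowerSeries.X : PowerSeries ℤ_[p]))))) ⧸
          LinearMap.range α) :=
  TelescopeK2WeightTwoControlMapOfFrobenius.exists_weightTwoControlMap_of_frobenius_of_split W hK hp2 hsplit κ hκ 𝔭bar h𝔭bar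
    he hf A₂ ρ₂ htor hcof S₀ hunr θ₀ hθσ hker hdeg fun w _ hw d =>
      TelescopeK2InertiaFrobeniusAnnihilatorBranch.exists_monic_frobeniusAnnihilator_of_fibreData W A₂ ρ₂ htor hcof θ₀ hker w hw d

/-- **SUB-LEAF W2 FROM FIBRE DATA + (split) UNDER THE HEEGNER HYPOTHESIS — NO inertia-side hypothesis.** p752662's
`exists_weightTwoControlMap_of_frobenius_of_heegner` with (ann) discharged: (deg₁) comes from `SatisfiesHeegnerHypothesis N₀ K` and
«every bad prime away from `p` divides `N₀`» (`hS₀N`). Remaining non-FD input: (split).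
[cite: Gross1991, §1 (the Heegner hypothesis)] [cite: Brink2007, Thm. 2 and Cor. 1 (pp. 2134–2136)]
[cite: JetchevSkinnerWan2017, §3.4, Lemma 3.4.1 (arXiv:1512.06894 p. 14)] [cite: Castella2018Erratum, Lemma 2.1 (p. 2)] -/
theorem exists_weightTwoControlMap_of_heegner
    (W : WeierstrassCurve ℚ) [W.IsElliptic] (hK : IsImaginaryQuadratic K) (hp2 : p ≠ 2)
    (hsplit : W.HasSplitMultiplicativeReductionAtPrime p)
    (κ : ZpExtension K p) (hκ : κ.IsAnticyclotomic)
    (𝔭bar : HeightOneSpectrum (𝓞 K)) (h𝔭bar : ((p : ℕ) : 𝓞 K) ∈ 𝔭bar.asIdeal)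
    (he : 𝔭bar.asIdeal.ramificationIdx (𝓞 ℚ) = 1) (hf : 𝔭bar.asIdeal.inertiaDeg (𝓞 ℚ) = 1)
    [TopologicalSpace (PowerSeries ℤ_[p])] (A₂ : Type) [AddCommGroup A₂] [Module (PowerSeries ℤ_[p]) A₂]
    [TopologicalSpace A₂] [DiscreteTopology A₂]
    (ρ₂ : ContinuousRep (absoluteGaloisGroup K) (PowerSeries ℤ_[p]) A₂)
    [TopologicalSpace (PowerSeries (PowerSeries ℤ_[p]))]
    [ContinuousSMul (PowerSeries (PowerSeries ℤ_[p])) (BigRepModule (PowerSeries ℤ_[p]) p A₂)]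
    (htor : ∀ a : A₂, ∃ n : ℕ, (PowerSeries.X : PowerSeries ℤ_[p]) ^ n • a = 0)
    (hcof : ∀ a : A₂, ∃ b : A₂, (PowerSeries.X : PowerSeries ℤ_[p]) • b = a)
    (S₀ : Finset (HeightOneSpectrum (𝓞 K))) (hunr : GaloisRep.IsUnramifiedOutside (S₀ : Set (HeightOneSpectrum (𝓞 K))) ρ₂)
    (θ₀ : Submodule.torsionBy (PowerSeries ℤ_[p]) A₂ (PowerSeries.X : PowerSeries ℤ_[p]) →+
      PrimaryTorsion (W.baseChange K).geomPoints p)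
    (hθσ : ∀ (σ : absoluteGaloisGroup K)
      (a : Submodule.torsionBy (PowerSeries ℤ_[p]) A₂ (PowerSeries.X : PowerSeries ℤ_[p])),
      θ₀ (BigGaloisRep.torsionRep ρ₂ (PowerSeries.X : PowerSeries ℤ_[p]) σ a) =
        (W.baseChange K).primaryTorsionGaloisRep p σ (θ₀ a))
    (hker : Finite θ₀.ker)
    -- Heegner: `K` satisfies the Heegner hypothesis for `N₀ ≠ 0` and the bad primes away from `p` divide `N₀`
    {N₀ : ℕ} (hN0 : N₀ ≠ 0) (hHeeg : SatisfiesHeegnerHypothesis N₀ K)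
    (hS₀N : ∀ w ∈ S₀, ((p : ℕ) : 𝓞 K) ∉ w.asIdeal → ((N₀ : ℕ) : 𝓞 K) ∈ w.asIdeal) :
    ∃ α : QuotSMulTop (PowerSeries.C (PowerSeries.X : PowerSeries ℤ_[p])) (XBig κ ρ₂ 𝔭bar (∅ : Set (HeightOneSpectrum (𝓞 K))))
        →ₗ[PowerSeries (PowerSeries ℤ_[p])]
        CharacterModule (TorsionControl.selmer (localMap K) (strictSet p 𝔭bar (∅ : Set (HeightOneSpectrum (𝓞 K))))
          (TorsionControl.torsionRep (AnticyclotomicBigGaloisRep κ ρ₂) (PowerSeries.C (PowerSeries.X : PowerSeries ℤ_[p])))),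
      (∀ m ∈ LinearMap.ker α, ∃ s : PowerSeries (PowerSeries ℤ_[p]),
        ¬ ((PowerSeries.C (PowerSeries.X : PowerSeries ℤ_[p])) ∣ s) ∧ s • m = 0) ∧
      Finite ((CharacterModule (TorsionControl.selmer (localMap K) (strictSet p 𝔭bar (∅ : Set (HeightOneSpectrum (𝓞 K))))
        (TorsionControl.torsionRep (AnticyclotomicBigGaloisRep κ ρ₂) (PowerSeries.C (PowerSeries.X : PowerSeries ℤ_[p]))))) ⧸
          LinearMap.range α) :=
  TelescopeK2WeightTwoControlMapOfFrobenius.exists_weightTwoControlMap_of_frobenius_of_heegner W hK hp2 hsplit κ hκ 𝔭bar h𝔭bar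
    he hf A₂ ρ₂ htor hcof S₀ hunr θ₀ hθσ hker hN0 hHeeg hS₀N fun w _ hw d =>
      TelescopeK2InertiaFrobeniusAnnihilatorBranch.exists_monic_frobeniusAnnihilator_of_fibreData W A₂ ρ₂ htor hcof θ₀ hker w hw d

end ControlMap

end Summit.BirchSwinnertonDyer.BirchSwinnertonDyer.Theorems.TelescopeK2InertiaFrobeniusAnnihilatorBranch

end
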